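import Summits.AtomisticToContinuum.HydrodynamicLimit.Theorems.LocalSecondLaw.Negative.Functional
import Literature.Analysis.FluidPDE.HardSphereFlowJointMeasurable

/-!
# The linear majorant of `-H` and the pathwise deviation bound of the `LocalSecondLaw` functional

Tightness programme, step A, for the crux `JParityClosure.LocalSecondLaw` (stmt-AtomisticToContinuum-13081;
standing disprover's `Cruxes/LocalSecondLaw/Disproof.lean`).  With `θ = (2/3)(e/ρ - m²/(2ρ²))` the guarded
entropy density of the crux satisfies `-H(ρ,θ) ≤ |e - 3/2| + (5/2)|ρ - 1|` (`neg_Hs_le_dev`: `ρ log ρ ≥ ρ - 1`,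
`ρ f_ex ≥ 0`, `(3/2)ρ log θ ≤ e - (3/2)ρ`), LINEAR in the deviations of the conserved fields from the unit
equilibrium — so smallness of the functional at equilibrium is an `L¹` statement, with no cold-spot/Jensen issue.
`dev`/`Dev = ∫ dev dx₀` are jointly continuous (`continuous_dev_uncurry`, `continuous_Dev` by
`continuous_parametric_integral_of_continuous`), `Dev ≤ 4 ke + 14` (`Dev_le`), the time section of the flow is
measurable on `Φ.good` (`measurable_flow_section`, from `HardSphereFlow.measurable_flow_prod_torus`), and on
`Φ.good`, for `φ(s,x) = ψ(s)` with `ψ' ≤ 0` continuous: `I(z) ≤ ∫₀¹ (-ψ') Dev(Φₛ z) ds`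
(`entropyFunctional_le_Dev`, junk branches included, right-hand side a genuine integral).  refuter-cdisprove-stmt-AtomisticToContinuum-13081-0.
-/

noncomputable section

namespace Summit.AtomisticToContinuum.HydrodynamicLimit.Theorems.LocalSecondLawNegative

open MeasureTheory Filter Set Topology
open scoped ENNReal
open Literature.MathematicalPhysics.KineticTheory Literature.Analysis.FluidPDE

variable {N : ℕ}

/-- Borel structure of `Config × 𝕋³` (instance search does not find `Prod.opensMeasurableSpace` here
unaided). [folklore] -/
instance instOpensMeasurableSpaceConfigProd :
    OpensMeasurableSpace (Config (N + 1) (Fin 3) T3 × T3) :=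
  Prod.opensMeasurableSpace

/-- `a - 1 ≤ a log a` for `a > 0`. [folklore] -/
theorem sub_one_le_mul_log {a : ℝ} (ha : 0 < a) : a - 1 ≤ a * Real.log a := by
  have h := Real.one_sub_inv_le_log_of_pos ha
  have : a * (1 - a⁻¹) = a - 1 := by field_simp
  nlinarith [mul_le_mul_of_nonneg_left h ha.le]

/-- **Linear majorant of the negative entropy density**: with `θ = (2/3)(e/ρ - m²/(2ρ²))`,
`-H(ρ, θ) ≤ |e - 3/2| + (5/2)|ρ - 1|` — LINEAR in the deviations of the conserved fields from the unit
equilibrium `(ρ, e) = (1, 3/2)`, guard and junk branches included (`ρ log ρ ≥ ρ - 1`, `ρ f_ex ≥ 0`,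
`(3/2)ρ log θ ≤ (3/2)ρ(θ - 1) ≤ e - (3/2)ρ`).  This is what makes tightness at equilibrium an `L¹`
statement about the mollified fields (no cold-spot / Jensen issue in expectation). [folklore] -/
theorem neg_Hs_le_dev (σ : ℝ) {a e m2 : ℝ} (hm2 : 0 ≤ m2) :
    -Hs σ a (2 / 3 * (e / a - m2 / (2 * a ^ 2))) ≤ |e - 3 / 2| + 5 / 2 * |a - 1| := by
  unfold Hs
  split_ifs with h
  · obtain ⟨ha, hb⟩ := h
    set b := 2 / 3 * (e / a - m2 / (2 * a ^ 2)) with hbdef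
    have h1 : a - 1 ≤ a * Real.log a := sub_one_le_mul_log ha
    have h2 : 0 ≤ a * hsExcessFreeEnergy (a * σ ^ 3) :=
      mul_nonneg ha.le (hsExcessFreeEnergy_nonneg _)
    have h3 : Real.log b ≤ b - 1 := Real.log_le_sub_one_of_pos hb
    have h4 : a * b ≤ 2 / 3 * e := by
      have : a * b = 2 / 3 * (e - m2 / (2 * a)) := by
        rw [hbdef]; field_simp
      rw [this]
      have : 0 ≤ m2 / (2 * a) := by positivity
      nlinarith
    have h5 : a * Real.log b ≤ a * (b - 1) := mul_le_mul_of_nonneg_left h3 ha.le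
    have h6 := le_abs_self (e - 3 / 2)
    have h7 := neg_abs_le (a - 1)
    nlinarith
  · rw [neg_zero]; positivity

/-- The deviation density `dev = |e_r - 3/2| + (5/2)|ρ_r - 1|` of a configuration at a field point. [folklore] -/
def dev (r : ℝ) (w : Config (N + 1) (Fin 3) T3) (x₀ : T3) : ℝ :=
  |kinC r w x₀ - 3 / 2| + 5 / 2 * |rhoC r w x₀ - 1|

/-- The integrated deviation `Dev = ∫ dev dx₀`. [folklore] -/
def Dev (r : ℝ) (w : Config (N + 1) (Fin 3) T3) : ℝ :=
  ∫ x₀, dev r w x₀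

/-- `dev ≥ 0`. [folklore] -/
theorem dev_nonneg (r : ℝ) (w : Config (N + 1) (Fin 3) T3) (x₀ : T3) : 0 ≤ dev r w x₀ := by
  unfold dev; positivity

/-- `Dev ≥ 0`. [folklore] -/
theorem Dev_nonneg (r : ℝ) (w : Config (N + 1) (Fin 3) T3) : 0 ≤ Dev r w :=
  integral_nonneg (dev_nonneg r w)

/-- `-H(ρ_r, θ_r) ≤ dev` pointwise. [folklore] -/
theorem neg_Hs_le_dev' (σ r : ℝ) (w : Config (N + 1) (Fin 3) T3) (x₀ : T3) :
    -Hs σ (rhoC r w x₀) (thetaC r w x₀) ≤ dev r w x₀ :=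
  neg_Hs_le_dev σ (sq_nonneg ‖momC r w x₀‖)

/-- The cone kernel along two continuous maps is continuous. [folklore] -/
theorem continuous_cone_comp {α : Type*} [TopologicalSpace α] (r : ℝ) {f g : α → T3}
    (hf : Continuous f) (hg : Continuous g) : Continuous fun a => cone r (f a) (g a) := by
  have h1 : Continuous fun a => ‖Torus.reprSym (f a - g a)‖ :=
    Torus.continuous_norm_reprSym.comp (hf.sub hg)
  have h2 : Continuous fun a => 3 / (Real.pi * r ^ 3) * max (1 - ‖Torus.reprSym (f a - g a)‖ / r) 0 :=
    continuous_const.mul ((continuous_const.sub (h1.div_const _)).max continuous_const)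
  exact h2

/-- The mollified density is jointly continuous in (configuration, field point). [folklore] -/
theorem continuous_rhoC_uncurry (r : ℝ) :
    Continuous fun p : Config (N + 1) (Fin 3) T3 × T3 => rhoC r p.1 p.2 := by
  have h : (fun p : Config (N + 1) (Fin 3) T3 × T3 => rhoC r p.1 p.2) =
      fun p => ((N + 1 : ℕ) : ℝ)⁻¹ * ∑ i, cone r (p.1 i).1 p.2 := by
    funext p; unfold rhoC; rw [integral_empiricalMeasure]
  rw [h]
  refine continuous_const.mul (continuous_finsetSum _ fun i _ => ?_)
  have hf : Continuous fun p : Config (N + 1) (Fin 3) T3 × T3 => (p.1 i).1 :=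
    ((continuous_apply i).comp continuous_fst).fst
  exact continuous_cone_comp r hf continuous_snd

/-- The mollified kinetic energy is jointly continuous in (configuration, field point). [folklore] -/
theorem continuous_kinC_uncurry (r : ℝ) :
    Continuous fun p : Config (N + 1) (Fin 3) T3 × T3 => kinC r p.1 p.2 := by
  have h : (fun p : Config (N + 1) (Fin 3) T3 × T3 => kinC r p.1 p.2) =
      fun p => ((N + 1 : ℕ) : ℝ)⁻¹ * ∑ i, cone r (p.1 i).1 p.2 * (‖(p.1 i).2‖ ^ 2 / 2) := by
    funext p; exact kinC_eq_sum r p.1 p.2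
  rw [h]
  refine continuous_const.mul (continuous_finsetSum _ fun i _ => ?_)
  have hf : Continuous fun p : Config (N + 1) (Fin 3) T3 × T3 => (p.1 i).1 :=
    ((continuous_apply i).comp continuous_fst).fst
  have hv : Continuous fun p : Config (N + 1) (Fin 3) T3 × T3 => ‖(p.1 i).2‖ ^ 2 / 2 :=
    (((continuous_apply i).comp continuous_fst).snd.norm.pow 2).div_const _
  exact (continuous_cone_comp r hf continuous_snd).mul hv

/-- `dev` is jointly continuous. [folklore] -/
theorem continuous_dev_uncurry (r : ℝ) :
    Continuous fun p : Config (N + 1) (Fin 3) T3 × T3 => dev r p.1 p.2 := by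
  unfold dev
  exact ((continuous_kinC_uncurry r).sub continuous_const).abs.add
    (continuous_const.mul ((continuous_rhoC_uncurry r).sub continuous_const).abs)

/-- `dev r w` is continuous in the field point. [folklore] -/
theorem continuous_dev (r : ℝ) (w : Config (N + 1) (Fin 3) T3) : Continuous fun x₀ => dev r w x₀ := by
  have h := (continuous_dev_uncurry (N := N) r).comp (Continuous.prodMk_right w)
  simpa only [Function.comp_def] using h

/-- `rhoC r w` is continuous in the field point. [folklore] -/
theorem continuous_rhoC (r : ℝ) (w : Config (N + 1) (Fin 3) T3) : Continuous fun x₀ => rhoC r w x₀ := by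
  have h := (continuous_rhoC_uncurry (N := N) r).comp (Continuous.prodMk_right w)
  simpa only [Function.comp_def] using h

/-- `Dev` is continuous (parametric integral of a jointly continuous integrand over the compact torus). [folklore] -/
theorem continuous_Dev (r : ℝ) : Continuous (Dev r : Config (N + 1) (Fin 3) T3 → ℝ) := by
  have h := continuous_parametric_integral_of_continuous
    (μ := (volume : Measure T3)) (f := fun (w : Config (N + 1) (Fin 3) T3) (x₀ : T3) => dev r w x₀)
    (continuous_dev_uncurry r) isCompact_univ
  show Continuous fun w : Config (N + 1) (Fin 3) T3 => ∫ x₀, dev r w x₀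
  simpa [Measure.restrict_univ] using h

/-- `∫ ρ_r ≤ 4`. [folklore] -/
theorem integral_rhoC_le {r : ℝ} (hr : 0 < r) (hr2 : r < 1 / 2) (w : Config (N + 1) (Fin 3) T3) :
    ∫ x₀, rhoC r w x₀ ≤ 4 := by
  have h : (rhoC r w : T3 → ℝ) = fun x₀ => ((N + 1 : ℕ) : ℝ)⁻¹ * ∑ i, cone r (w i).1 x₀ := by
    funext x₀; unfold rhoC; rw [integral_empiricalMeasure]
  rw [h, integral_const_mul, integral_finsetSum Finset.univ (f := fun i a => cone r (w i).1 a)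
    (fun i _ => integrable_of_continuous_T3 (continuous_cone r _))]
  calc ((N + 1 : ℕ) : ℝ)⁻¹ * ∑ i, ∫ a, cone r (w i).1 a
      ≤ ((N + 1 : ℕ) : ℝ)⁻¹ * ∑ _i : Fin (N + 1), (4 : ℝ) := by
        gcongr with i
        exact integral_cone_le hr hr2 _
    _ = 4 := by
        rw [Finset.sum_const, Finset.card_univ, Fintype.card_fin, nsmul_eq_mul]
        field_simp

/-- `ρ_r ≥ 0`. [folklore] -/
theorem rhoC_nonneg {r : ℝ} (hr : 0 < r) (w : Config (N + 1) (Fin 3) T3) (x₀ : T3) : 0 ≤ rhoC r w x₀ := by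
  unfold rhoC; rw [integral_empiricalMeasure]
  exact mul_nonneg (by positivity) (Finset.sum_nonneg fun i _ => cone_nonneg hr _ _)

/-- `Dev ≤ 4 ke + 14` (`dev ≤ e_r + (5/2)ρ_r + 4`, `∫ e_r ≤ 4 ke`, `∫ ρ_r ≤ 4`). [folklore] -/
theorem Dev_le {r : ℝ} (hr : 0 < r) (hr2 : r < 1 / 2) (w : Config (N + 1) (Fin 3) T3) :
    Dev r w ≤ 4 * ke w + 14 := by
  have hpt : ∀ x₀, dev r w x₀ ≤ kinC r w x₀ + (5 / 2 * rhoC r w x₀ + 4) := by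
    intro x₀
    unfold dev
    have hk := kinC_nonneg hr w x₀
    have hρ := rhoC_nonneg hr w x₀
    cases abs_cases (kinC r w x₀ - 3 / 2) <;> cases abs_cases (rhoC r w x₀ - 1) <;> nlinarith
  have hik : Integrable (fun x₀ => kinC r w x₀) := integrable_of_continuous_T3 (continuous_kinC r w)
  have hiρ : Integrable (fun x₀ => rhoC r w x₀) := integrable_of_continuous_T3 (continuous_rhoC r w)
  have hiρ' : Integrable (fun x₀ => 5 / 2 * rhoC r w x₀) := hiρ.const_mul _
  have hig : Integrable (fun x₀ => 5 / 2 * rhoC r w x₀ + 4) := hiρ'.add (integrable_const _)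
  have hid : Integrable (fun x₀ => dev r w x₀) := integrable_of_continuous_T3 (continuous_dev r w)
  unfold Dev
  calc ∫ x₀, dev r w x₀ ≤ ∫ x₀, (kinC r w x₀ + (5 / 2 * rhoC r w x₀ + 4)) :=
        integral_mono hid (hik.add hig) hpt
    _ = (∫ x₀, kinC r w x₀) + (5 / 2 * (∫ x₀, rhoC r w x₀) + 4) := by
        rw [integral_add hik hig, integral_add hiρ' (integrable_const _), integral_const_mul,
          integral_const]
        simp
    _ ≤ 4 * ke w + (5 / 2 * 4 + 4) := by
        have h1 := integral_kinC_le hr hr2 w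
        have h2 := integral_rhoC_le hr hr2 w
        gcongr
    _ = 4 * ke w + 14 := by ring

/-- The time section `s ↦ Φₛ z` of the flow is measurable for `z ∈ Φ.good`
(section of the jointly measurable `HardSphereFlow.measurable_flow_prod_torus`). [folklore] -/
theorem measurable_flow_section {σ : ℝ}
    (Φ : HardSphereFlow (Torus.geometry (Fin 3)) (hsDiameter σ N) (N + 1))
    {z : Config (N + 1) (Fin 3) T3} (hz : z ∈ Φ.good) : Measurable fun s : ℝ => Φ.flow s z := by
  have h := Φ.measurable_flow_prod_torus
  have hi : Measurable fun s : ℝ => ((⟨z, hz⟩ : Φ.good), s) := measurable_const.prodMk measurable_id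
  exact h.comp hi

/-- Per-instant deviation bound: `∫ H ψ' ≤ -ψ' · Dev` for `ψ' ≤ 0`, junk branch included. [folklore] -/
theorem inner_le_Dev (r σ : ℝ) (w : Config (N + 1) (Fin 3) T3)
    {c : ℝ} (hc : c ≤ 0) :
    ∫ x₀, Hs σ (rhoC r w x₀) (thetaC r w x₀) * c ≤ -c * Dev r w := by
  have hpt : ∀ x₀, Hs σ (rhoC r w x₀) (thetaC r w x₀) * c ≤ dev r w x₀ * (-c) := fun x₀ => by
    have h := neg_Hs_le_dev' σ r w x₀
    nlinarith
  have hD := Dev_nonneg r w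
  by_cases hint : Integrable (fun x₀ => Hs σ (rhoC r w x₀) (thetaC r w x₀) * c)
  · calc ∫ x₀, Hs σ (rhoC r w x₀) (thetaC r w x₀) * c ≤ ∫ x₀, dev r w x₀ * (-c) :=
          integral_mono hint ((integrable_of_continuous_T3 (continuous_dev r w)).mul_const _) hpt
      _ = -c * Dev r w := by rw [integral_mul_const]; unfold Dev; ring
  · rw [integral_undef hint]
    have : 0 ≤ -c := by linarith
    positivity

/-- **Pathwise deviation bound of the entropy functional.**  On `Φ.good`, for `φ(s,x) = ψ(s)` with
`ψ` differentiable, `ψ'` continuous, `ψ` non-increasing (horizon `1`):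
`I(z) ≤ ∫₀¹ (-ψ'(s)) · Dev(Φₛ z) ds` (`ψ` differentiable with continuous `ψ' ≤ 0`), where
`Dev = ∫ |e_r - 3/2| + (5/2)|ρ_r - 1| dx₀` is the
integrated deviation of the mollified conserved fields from the unit equilibrium; the junk branches
satisfy it trivially, and the right-hand side is a genuine integral (measurable time section,
`Dev ≤ 4 ke + 14` by energy conservation). [folklore] -/
theorem entropyFunctional_le_Dev {σ r : ℝ} (hr : 0 < r) (hr2 : r < 1 / 2)
    (Φ : HardSphereFlow (Torus.geometry (Fin 3)) (hsDiameter σ N) (N + 1))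
    {ψ : ℝ → ℝ} (hψc : Continuous (deriv ψ)) (hanti : Antitone ψ)
    {z : Config (N + 1) (Fin 3) T3} (hz : z ∈ Φ.good) :
    entropyFunctional σ r 1 (fun s _ => ψ s) Φ z ≤
      ∫ s in Set.Icc (0 : ℝ) 1, -deriv ψ s * Dev r (Φ.flow s z) := by
  have hpd : ∀ (k : Fin 3) (s : ℝ) (x : T3),
      Literature.Analysis.FunctionSpaces.Torus.partialDeriv k (fun _ : T3 => ψ s) x = 0 := by
    intro k s x
    simp [Literature.Analysis.FunctionSpaces.Torus.partialDeriv,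
      Literature.Analysis.FunctionSpaces.Torus.lineDeriv]
  unfold entropyFunctional
  simp only [hpd, mul_zero, Finset.sum_const_zero, add_zero]
  have hG : ∀ s, ∫ x, Hs σ (rhoC r (Φ.flow s z) x) (thetaC r (Φ.flow s z) x) * deriv ψ s ≤
      -deriv ψ s * Dev r (Φ.flow s z) := fun s => inner_le_Dev r σ _ hanti.deriv_nonpos
  -- the right-hand side is integrable on [0, 1]
  obtain ⟨M, hM⟩ := isCompact_Icc.exists_bound_of_continuousOn
    (hψc.continuousOn : ContinuousOn (deriv ψ) (Set.Icc (0 : ℝ) 1))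
  have hmeasD : Measurable fun s => Dev r (Φ.flow s z) :=
    (continuous_Dev r).measurable.comp (measurable_flow_section Φ hz)
  haveI : IsFiniteMeasure ((volume : Measure ℝ).restrict (Set.Icc (0 : ℝ) 1)) :=
    ⟨by rw [Measure.restrict_apply_univ]; exact measure_Icc_lt_top⟩
  have hRint : IntegrableOn (fun s => -deriv ψ s * Dev r (Φ.flow s z)) (Set.Icc (0 : ℝ) 1) := by
    refine Integrable.mono' (integrable_const (M * (4 * ke z + 14)))
      ((hψc.measurable.neg.mul hmeasD).aestronglyMeasurable) ?_
    refine ae_restrict_of_forall_mem measurableSet_Icc fun s hs => ?_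
    have h1 : |deriv ψ s| ≤ M := by simpa [Real.norm_eq_abs] using hM s hs
    have h2 : Dev r (Φ.flow s z) ≤ 4 * ke z + 14 := by
      rw [← ke_flow_eq Φ hz s]; exact Dev_le hr hr2 _
    have h3 := Dev_nonneg r (Φ.flow s z)
    have hke := ke_nonneg z
    rw [Real.norm_eq_abs, abs_mul, abs_neg, abs_of_nonneg h3]
    exact mul_le_mul h1 h2 h3 ((abs_nonneg _).trans h1)
  by_cases hint : IntegrableOn (fun s => ∫ x, Hs σ (rhoC r (Φ.flow s z) x)
      (thetaC r (Φ.flow s z) x) * deriv ψ s) (Set.Icc (0 : ℝ) 1)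
  · exact integral_mono hint hRint hG
  · rw [integral_undef hint]
    exact setIntegral_nonneg measurableSet_Icc fun s _ =>
      mul_nonneg (neg_nonneg.2 hanti.deriv_nonpos) (Dev_nonneg _ _)


end Summit.AtomisticToContinuum.HydrodynamicLimit.Theorems.LocalSecondLawNegative

end
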